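import Summits.FinalStateConjecture.FinalStateConjecture.Theorems.EIHFluxBalanceInertialRecessionStubSlavingCOERLie
import Literature.Geometry.Lorentzian.KerrConvergence

/-!
# Route EIHFluxBalance — `InertialRecession` (E′), stub `stub_slaving`:
# the kernel of the first variation of the static Schwarzschild components under a GENERAL
# infinitesimal Poincaré motion (all boosts): rotations are Killing, and four events in general
# position leave only the static Killing field

Helper file for the crux `stmt-FinalStateConjecture-17403`
(`Summit.FinalStateConjecture.FinalStateConjecture.Theses.EIHFluxBalance.InertialRecession`, E′),
stub `stub_slaving`, part (B2′) of the all-boost coercivity programme (memo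
`COER_allboosts_routes.md`, note `COER_progress_note1.md`): `…StubSlavingCOERLie` treated the
generator `Z(x) = ωx + q` with a pure boost part `ω = e₀ ∧ p`. Along a real motion the body rate
`Ω = (d/ds Λ⁻¹) ∘ Λ₀` is a general element of `so(1,3)`; here we remove its rotation part.

* `lieDeriv_bilin_zero_spin_rotation_eq_zero` — **rotations are Killing for `g_{M,0}`**: for a
  spatial, `e₀`-killing, spatially skew operator `R`,
  `∂_{Rx} g + g(R·, ·) + g(·, R·) = 0` at every `x` off the time axis (closed forms of
  `SchwarzschildKerrSchildComponents`);
* `skew_decomposition` — an `η`-skew `Ω` splits as `Ω = ω_p + ρ` with `p = Ω e₀` spatial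
  (`ω_p A = (⟪p⃗,A⃗⟫, A⁰ p⃗)`) and `ρ` a spatial rotation generator as above;
* `spatial_eq_zero_of_lieDeriv_skew_eq_zero_four_events` — **kernel theorem**: if `M ≠ 0`, `Ω` is
  `η`-skew and `∂_{Ωyₖ + q} g + g(Ω·, ·) + g(·, Ω·) = 0` at four events `yₖ` off the time axis whose
  spatial parts are in general position, then `(Ω e₀)⃗ = 0` and `q⃗ = 0` — the motion is
  instantaneously a rotation plus a time translation, i.e. Killing. This is the injectivity, modulo
  the Killing directions, of the linear map "generator ↦ first variation of the painted summand at
  the evaluation events", for every boost (the events are arbitrary);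
* `hasDerivAt_boostedKerrBilin_zero_spin_motion` — along a motion `(Λ(s), c(s))` the first
  variation `d/ds boostedKerrBilin (Λ s) (c s) M 0 x` IS that form, with `Ω = D ∘ Λ₀`
  (`D = d/ds Λ⁻¹`, `η`-skew by `minkowski_skew_of_hasDerivAt_lorentz_symm`) and `q = −Λ₀⁻¹ċ`;
* `spatial_eq_zero_of_deriv_boostedKerrBilin_eq_zero_four_events` — **(B2′) along a motion**: if the
  first variation of the painted Schwarzschild summand vanishes at four lab events whose rest images
  are in general position, the rest-frame spatial parts of `D u₀` (`= −Λ₀⁻¹u̇₀`) and `Λ₀⁻¹ċ`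
  vanish (registered carrier `coer_motion_four_event_rigidity_s0`).

Elementary; no definitions, no named facts, no `sorry`.
-/

set_option linter.dupNamespace false
set_option maxSynthPendingDepth 3

noncomputable section

open Set Function Module Submodule Literature.Geometry.Lorentzian
  Literature.Geometry.Lorentzian.Schwarzschild
open scoped InnerProductSpace

namespace Summit.FinalStateConjecture.FinalStateConjecture.Theorems.SublinearIsFree.Slaving

/-! ### Rotations are Killing for the static Schwarzschild components -/

section Rotation

variable {x : E4}

/-- **Infinitesimal rotations are Killing for `g_{M,0}`.** Let `R : E4 → E4` be any map with
spatial values (`(RA)⁰ = 0`) that is spatially skew (`⟪(RA)⃗, B⃗⟫ = −⟪A⃗, (RB)⃗⟫`; linearity is not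
needed). Then off the time axis
`∂_{Rx} g(A,B) + g(RA, B) + g(A, RB) = 0` for `g = Kerr.bilin M 0` (spherical symmetry of
Schwarzschild: `∂_{Rx}(1/r) = 0`, `∂_{Rx}ℓ(A) = ⟪(Rx)⃗,A⃗⟫/r = −ℓ(RA)`). [cite: KerrSchild1965, §2] -/
theorem lieDeriv_bilin_zero_spin_rotation_eq_zero (M : ℝ) (hx : E4.spatial x ≠ 0)
    {R : E4 → E4} (hR0 : ∀ A, R A 0 = 0)
    (hRskew : ∀ A B, sdot (R A) B = -sdot A (R B)) (A B : E4) :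
    fderiv ℝ (Kerr.bilin M 0) x (R x) A B + Kerr.bilin M 0 x (R A) B + Kerr.bilin M 0 x A (R B) = 0 := by
  have hr : E4.spatialNorm x ≠ 0 := by rwa [E4.spatialNorm, norm_ne_zero_iff]
  have hxx : sdot x (R x) = 0 := by
    have h := hRskew x x
    rw [sdot_comm (R x) x] at h
    linarith
  have hxA : sdot x (R A) = -sdot (R x) A := by have h := hRskew x A; linarith
  have hxB : sdot x (R B) = -sdot (R x) B := by have h := hRskew x B; linarith
  have hAB : sdot (R A) B = -sdot A (R B) := hRskew A B
  rw [fderiv_bilin_zero_spin_apply M hx, bilin_zero_eq M hx, bilin_zero_eq M hx, dG, dEll_eq, dEll_eq]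
  simp only [ell, proj, hR0, hxx, hxA, hxB, hAB]
  field_simp
  ring

end Rotation

/-! ### Decomposition of an `η`-skew operator into boost and rotation parts -/

section Decomposition

/-- **Boost/rotation decomposition of an `η`-skew operator.** If `η(ΩA, B) + η(A, ΩB) = 0` for all
`A, B`, then with `p = Ω e₀` (`e₀ = (1, 0⃗)`): `p⁰ = 0`, and `ρ A := Ω A − (⟪p⃗,A⃗⟫, A⁰ p⃗)` is a
spatial rotation generator — `(ρA)⁰ = 0`, `ρ e₀ = 0`, `⟪(ρA)⃗, B⃗⟫ = −⟪A⃗, (ρB)⃗⟫`. [folklore] -/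
theorem skew_decomposition {Ω : E4 →L[ℝ] E4}
    (hΩ : ∀ A B, Minkowski.bilin (Ω A) B + Minkowski.bilin A (Ω B) = 0) :
    Ω (E4.ofTimeSpace 1 0) 0 = 0 ∧
    (∀ A, (Ω A - E4.ofTimeSpace (sdot (Ω (E4.ofTimeSpace 1 0)) A)
      (A 0 • E4.spatial (Ω (E4.ofTimeSpace 1 0)))) 0 = 0) ∧
    (Ω (E4.ofTimeSpace 1 0) - E4.ofTimeSpace (sdot (Ω (E4.ofTimeSpace 1 0)) (E4.ofTimeSpace 1 0))
      ((E4.ofTimeSpace 1 0 : E4) 0 • E4.spatial (Ω (E4.ofTimeSpace 1 0))) = 0) ∧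
    (∀ A B, sdot (Ω A - E4.ofTimeSpace (sdot (Ω (E4.ofTimeSpace 1 0)) A)
        (A 0 • E4.spatial (Ω (E4.ofTimeSpace 1 0)))) B =
      -sdot A (Ω B - E4.ofTimeSpace (sdot (Ω (E4.ofTimeSpace 1 0)) B)
        (B 0 • E4.spatial (Ω (E4.ofTimeSpace 1 0))))) := by
  set e₀ : E4 := E4.ofTimeSpace 1 0 with he₀
  set p : E4 := Ω e₀ with hp
  have hsk : ∀ A B, -(Ω A 0 * B 0) + sdot (Ω A) B + (-(A 0 * Ω B 0) + sdot A (Ω B)) = 0 := by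
    intro A B
    have h := hΩ A B
    rwa [Kerr.minkowski_bilin_eq_spatial, Kerr.minkowski_bilin_eq_spatial] at h
  have he₀0 : e₀ 0 = 1 := by simp [he₀]
  have he₀s : E4.spatial e₀ = 0 := by simp [he₀]
  have hse₀ : ∀ A, sdot A e₀ = 0 := fun A ↦ by simp [sdot, he₀s]
  have hse₀' : ∀ A, sdot e₀ A = 0 := fun A ↦ by simp [sdot, he₀s]
  -- `p⁰ = 0`
  have hp0 : p 0 = 0 := by
    have h := hsk e₀ e₀
    rw [he₀0, hse₀, hse₀'] at h
    rw [hp]; linarith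
  -- `(ΩA)⁰ = ⟪A⃗, p⃗⟫`
  have hΩ0 : ∀ A, Ω A 0 = sdot A p := by
    intro A
    have h := hsk A e₀
    rw [he₀0, hse₀, ← hp, hp0] at h
    linarith
  refine ⟨hp0, fun A ↦ ?_, ?_, fun A B ↦ ?_⟩
  · simp only [PiLp.sub_apply, E4.ofTimeSpace_apply_zero, hΩ0, sdot_comm]
    ring
  · rw [he₀0, one_smul, hse₀]
    have : E4.ofTimeSpace 0 (E4.spatial p) = p := by
      have h := E4.ofTimeSpace_time_spatial p
      rwa [show E4.time p = 0 from hp0] at h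
    rw [this, sub_self]
  · have h := hsk A B
    rw [hΩ0, hΩ0] at h
    simp only [sdot, map_sub, E4.spatial_ofTimeSpace, inner_sub_left, inner_sub_right,
      inner_smul_left, inner_smul_right, RCLike.conj_to_real] at h ⊢
    linear_combination h + (A 0) * real_inner_comm (E4.spatial p) (E4.spatial B)

end Decomposition

/-! ### The kernel theorem for a general `η`-skew generator -/

section Kernel

/-- **Kernel of the first variation of `g_{M,0}` under a general infinitesimal Poincaré motion, at
four events in general position.** Let `M ≠ 0`, `Ω : E4 →L E4` be `η`-skew, `q ∈ E4`, and `y₀,…,y₃`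
events off the time axis whose spatial parts are in general position (every three linearly
independent). If `∂_{Ωyₖ + q} g(A,B) + g(ΩA, B) + g(A, ΩB) = 0` for all `A, B` at each `yₖ`
(`g = Kerr.bilin M 0`), then `(Ωe₀)⃗ = 0` and `q⃗ = 0`: the generator is a spatial rotation plus a
time translation (`skew_decomposition`, `lieDeriv_bilin_zero_spin_rotation_eq_zero`,
`spatial_eq_zero_of_lieDeriv_eq_zero_four_events`). [cite: KerrSchild1965, §2] -/
theorem spatial_eq_zero_of_lieDeriv_skew_eq_zero_four_events {M : ℝ} (hM : M ≠ 0)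
    {Ω : E4 →L[ℝ] E4} (hΩ : ∀ A B, Minkowski.bilin (Ω A) B + Minkowski.bilin A (Ω B) = 0)
    (q : E4) (y : Fin 4 → E4) (hy : ∀ k, E4.spatial (y k) ≠ 0)
    (hind : ∀ i j k : Fin 4, i ≠ j → j ≠ k → i ≠ k →
      LinearIndependent ℝ ![E4.spatial (y i), E4.spatial (y j), E4.spatial (y k)])
    (h : ∀ k, ∀ A B : E4, fderiv ℝ (Kerr.bilin M 0) (y k) (Ω (y k) + q) A B
      + Kerr.bilin M 0 (y k) (Ω A) B + Kerr.bilin M 0 (y k) A (Ω B) = 0) :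
    E4.spatial (Ω (E4.ofTimeSpace 1 0)) = 0 ∧ E4.spatial q = 0 := by
  obtain ⟨hp0, hρ0, -, hρskew⟩ := skew_decomposition hΩ
  set p : E4 := Ω (E4.ofTimeSpace 1 0) with hp
  -- the rotation part, as a plain map
  set ρ : E4 → E4 := fun A ↦ Ω A - E4.ofTimeSpace (sdot p A) (A 0 • E4.spatial p) with hρ
  have hsplit : ∀ A, Ω A = E4.ofTimeSpace (sdot p A) (A 0 • E4.spatial p) + ρ A := by
    intro A; simp only [hρ]; abel
  -- remove the rotation part from the hypothesis
  have h' : ∀ k, ∀ A B : E4,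
      fderiv ℝ (Kerr.bilin M 0) (y k) (E4.ofTimeSpace (sdot p (y k)) ((y k) 0 • E4.spatial p) + q) A B
        + Kerr.bilin M 0 (y k) (E4.ofTimeSpace (sdot p A) (A 0 • E4.spatial p)) B
        + Kerr.bilin M 0 (y k) A (E4.ofTimeSpace (sdot p B) (B 0 • E4.spatial p)) = 0 := by
    intro k A B
    have h1 := h k A B
    have hrot := lieDeriv_bilin_zero_spin_rotation_eq_zero M (hy k) (R := ρ) hρ0 hρskew A B
    rw [hsplit (y k), hsplit A, hsplit B] at h1
    simp only [map_add, add_apply] at h1 ⊢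
    linear_combination h1 - hrot
  refine spatial_eq_zero_of_lieDeriv_eq_zero_four_events hM p q y
    (fun k ↦ E4.ofTimeSpace (sdot p (y k)) ((y k) 0 • E4.spatial p) + q) hy hind (fun k ↦ ?_) h'
  rw [map_add, E4.spatial_ofTimeSpace, add_comm]

end Kernel

/-! ### Along a motion: the first variation of the painted Schwarzschild summand -/

section Path

variable {Λ : ℝ → lorentzGroup} {c : ℝ → E4} {M : ℝ} {s₀ : ℝ} {D : E4 →L[ℝ] E4} {cdot : E4}

/-- The rest-frame point `y(s) = Λ(s)⁻¹(x − c(s))` along a motion: derivative `D(x − c₀) − Λ₀⁻¹ċ`.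
[folklore] -/
theorem hasDerivAt_restPoint_motion
    (hΛ : HasDerivAt (fun s ↦ (((Λ s : E4 ≃L[ℝ] E4).symm : E4 →L[ℝ] E4))) D s₀)
    (hc : HasDerivAt c cdot s₀) (x : E4) :
    HasDerivAt (fun s ↦ (((Λ s : E4 ≃L[ℝ] E4).symm : E4 →L[ℝ] E4)) (x - c s))
      (D (x - c s₀) - (((Λ s₀ : E4 ≃L[ℝ] E4).symm : E4 →L[ℝ] E4)) cdot) s₀ := by
  have h := hΛ.clm_apply ((hasDerivAt_const s₀ x).sub hc)
  rw [zero_sub, map_neg, ← sub_eq_add_neg] at h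
  exact h

/-- The static components along the rest-frame point of a motion: derivative by the chain rule.
[folklore] -/
theorem hasDerivAt_bilin_restPoint_motion
    (hΛ : HasDerivAt (fun s ↦ (((Λ s : E4 ≃L[ℝ] E4).symm : E4 →L[ℝ] E4))) D s₀)
    (hc : HasDerivAt c cdot s₀) {x : E4}
    (hx : E4.spatial ((((Λ s₀ : E4 ≃L[ℝ] E4).symm : E4 →L[ℝ] E4)) (x - c s₀)) ≠ 0) :
    HasDerivAt (fun s ↦ Kerr.bilin M 0 ((((Λ s : E4 ≃L[ℝ] E4).symm : E4 →L[ℝ] E4)) (x - c s)))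
      (fderiv ℝ (Kerr.bilin M 0) ((((Λ s₀ : E4 ≃L[ℝ] E4).symm : E4 →L[ℝ] E4)) (x - c s₀))
        (D (x - c s₀) - (((Λ s₀ : E4 ≃L[ℝ] E4).symm : E4 →L[ℝ] E4)) cdot)) s₀ := by
  have hr : 0 < Kerr.radius 0 ((((Λ s₀ : E4 ≃L[ℝ] E4).symm : E4 →L[ℝ] E4)) (x - c s₀)) := by
    rw [Kerr.radius_zero_left, E4.spatialNorm]; exact norm_pos_iff.2 hx
  have hK : HasFDerivAt (Kerr.bilin M 0)
      (fderiv ℝ (Kerr.bilin M 0) ((((Λ s₀ : E4 ≃L[ℝ] E4).symm : E4 →L[ℝ] E4)) (x - c s₀)))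
      ((((Λ s₀ : E4 ≃L[ℝ] E4).symm : E4 →L[ℝ] E4)) (x - c s₀)) :=
    ((Kerr.contDiffAt_bilin M 0 hr (n := 1)).differentiableAt one_ne_zero).hasFDerivAt
  exact hK.comp_hasDerivAt s₀ (hasDerivAt_restPoint_motion hΛ hc x)

/-- **The first variation of the painted Schwarzschild summand along a motion is the Lie derivative
of the static components along the induced generator.** If `s ↦ Λ(s)⁻¹` (as operators) has
derivative `D` at `s₀` and `c` has derivative `ċ`, then at a lab point `x` whose rest image
`y = Λ₀⁻¹(x − c₀)` is off the time axis,
`d/ds|_{s₀} boostedKerrBilin (Λ s) (c s) M 0 x v w = ∂_{D(x−c₀) − Λ₀⁻¹ċ} g(A,B) + g(Dv, B) + g(A, Dw)`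
with `A = Λ₀⁻¹v`, `B = Λ₀⁻¹w`, `g = Kerr.bilin M 0` at `y` (chain rule through
`boostedKerrBilin_apply`). [cite: KerrSchild1965, §2] -/
theorem hasDerivAt_boostedKerrBilin_zero_spin_motion
    (hΛ : HasDerivAt (fun s ↦ (((Λ s : E4 ≃L[ℝ] E4).symm : E4 →L[ℝ] E4))) D s₀)
    (hc : HasDerivAt c cdot s₀) {x : E4}
    (hx : E4.spatial (poincareInv (Λ s₀) (c s₀) x) ≠ 0) (v w : E4) :
    HasDerivAt (fun s ↦ boostedKerrBilin (Λ s) (c s) M 0 x v w)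
      (fderiv ℝ (Kerr.bilin M 0) (poincareInv (Λ s₀) (c s₀) x)
          (D (x - c s₀) - (((Λ s₀ : E4 ≃L[ℝ] E4).symm : E4 →L[ℝ] E4)) cdot)
          ((((Λ s₀ : E4 ≃L[ℝ] E4).symm : E4 →L[ℝ] E4)) v) ((((Λ s₀ : E4 ≃L[ℝ] E4).symm : E4 →L[ℝ] E4)) w)
        + Kerr.bilin M 0 (poincareInv (Λ s₀) (c s₀) x) (D v) ((((Λ s₀ : E4 ≃L[ℝ] E4).symm : E4 →L[ℝ] E4)) w)
        + Kerr.bilin M 0 (poincareInv (Λ s₀) (c s₀) x) ((((Λ s₀ : E4 ≃L[ℝ] E4).symm : E4 →L[ℝ] E4)) v) (D w))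
      s₀ := by
  have hpt : poincareInv (Λ s₀) (c s₀) x = (((Λ s₀ : E4 ≃L[ℝ] E4).symm : E4 →L[ℝ] E4)) (x - c s₀) := rfl
  rw [hpt] at hx ⊢
  have hA : HasDerivAt (fun s ↦ (((Λ s : E4 ≃L[ℝ] E4).symm : E4 →L[ℝ] E4)) v) (D v) s₀ := by
    have h := hΛ.clm_apply (hasDerivAt_const s₀ v)
    rw [map_zero, add_zero] at h
    exact h
  have hB : HasDerivAt (fun s ↦ (((Λ s : E4 ≃L[ℝ] E4).symm : E4 →L[ℝ] E4)) w) (D w) s₀ := by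
    have h := hΛ.clm_apply (hasDerivAt_const s₀ w)
    rw [map_zero, add_zero] at h
    exact h
  have h1 := ((hasDerivAt_bilin_restPoint_motion (M := M) hΛ hc hx).clm_apply hA).clm_apply hB
  have hfun : (fun s ↦ boostedKerrBilin (Λ s) (c s) M 0 x v w) = fun s ↦
      Kerr.bilin M 0 ((((Λ s : E4 ≃L[ℝ] E4).symm : E4 →L[ℝ] E4)) (x - c s))
        ((((Λ s : E4 ≃L[ℝ] E4).symm : E4 →L[ℝ] E4)) v) ((((Λ s : E4 ≃L[ℝ] E4).symm : E4 →L[ℝ] E4)) w) := by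
    funext s
    rw [boostedKerrBilin_apply]
    rfl
  rw [hfun]
  refine h1.congr_deriv ?_
  rw [add_apply]

/-- **The induced generator is `η`-skew**: if `Λ(s) ∈ O(1,3)` and `s ↦ Λ(s)⁻¹` has derivative `D`
at `s₀`, then `Ω = D ∘ Λ₀` satisfies `η(ΩA, B) + η(A, ΩB) = 0` (differentiate
`η(Λ⁻¹v, Λ⁻¹w) = η(v, w)`). [folklore] -/
theorem minkowski_skew_of_hasDerivAt_lorentz_symm
    (hΛ : HasDerivAt (fun s ↦ (((Λ s : E4 ≃L[ℝ] E4).symm : E4 →L[ℝ] E4))) D s₀) (A B : E4) :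
    Minkowski.bilin (D ((Λ s₀ : E4 ≃L[ℝ] E4) A)) B + Minkowski.bilin A (D ((Λ s₀ : E4 ≃L[ℝ] E4) B)) = 0 := by
  set Li : ℝ → E4 →L[ℝ] E4 := fun s ↦ (((Λ s : E4 ≃L[ℝ] E4).symm : E4 →L[ℝ] E4)) with hLi
  set v : E4 := (Λ s₀ : E4 ≃L[ℝ] E4) A with hv
  set w : E4 := (Λ s₀ : E4 ≃L[ℝ] E4) B with hw
  have hA : HasDerivAt (fun s ↦ Li s v) (D v + Li s₀ 0) s₀ := hΛ.clm_apply (hasDerivAt_const s₀ v)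
  have hB : HasDerivAt (fun s ↦ Li s w) (D w + Li s₀ 0) s₀ := hΛ.clm_apply (hasDerivAt_const s₀ w)
  have hη := (((Minkowski.bilin : E4 →L[ℝ] E4 →L[ℝ] ℝ).hasFDerivAt).comp_hasDerivAt s₀ hA).clm_apply hB
  have hconst : (fun s ↦ Minkowski.bilin (Li s v) (Li s w)) = fun _ ↦ Minkowski.bilin v w := by
    funext s
    exact (lorentzGroup.inv_mem (Λ s).2) v w
  have hzero : HasDerivAt (fun s ↦ Minkowski.bilin (Li s v) (Li s w)) 0 s₀ := by
    rw [hconst]; exact hasDerivAt_const s₀ _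
  have heq := hη.unique hzero
  have hAv : Li s₀ v = A := by simp [hLi, hv]
  have hBw : Li s₀ w = B := by simp [hLi, hw]
  simp only [map_zero, add_zero, Function.comp_apply, hAv, hBw] at heq
  linear_combination heq

/-- **(B2′) along a motion.** Let `M ≠ 0`, `Λ : ℝ → O(1,3)` with `s ↦ Λ(s)⁻¹` differentiable at `s₀`
(derivative `D`), `c` differentiable at `s₀` (derivative `ċ`), and four lab events `xₖ` whose rest
images `yₖ = Λ₀⁻¹(xₖ − c₀)` are off the time axis with spatial parts in general position. If the
first variation of the painted summand vanishes at the four events,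
`d/ds|_{s₀} boostedKerrBilin (Λ s) (c s) M 0 xₖ = 0`, then the motion is instantaneously Killing:
the rest-frame spatial parts of `D u₀` (`u₀ = Λ₀ e₀`; `D u₀ = −Λ₀⁻¹ u̇₀`) and of `Λ₀⁻¹ ċ` vanish,
i.e. `u̇₀ = 0` up to the hyperboloid constraint and `ċ ∥ u₀`. [cite: KerrSchild1965, §2] -/
theorem spatial_eq_zero_of_deriv_boostedKerrBilin_eq_zero_four_events (hM : M ≠ 0)
    (hΛ : HasDerivAt (fun s ↦ (((Λ s : E4 ≃L[ℝ] E4).symm : E4 →L[ℝ] E4))) D s₀)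
    (hc : HasDerivAt c cdot s₀) (x : Fin 4 → E4)
    (hx : ∀ k, E4.spatial (poincareInv (Λ s₀) (c s₀) (x k)) ≠ 0)
    (hind : ∀ i j k : Fin 4, i ≠ j → j ≠ k → i ≠ k →
      LinearIndependent ℝ ![E4.spatial (poincareInv (Λ s₀) (c s₀) (x i)),
        E4.spatial (poincareInv (Λ s₀) (c s₀) (x j)), E4.spatial (poincareInv (Λ s₀) (c s₀) (x k))])
    (h : ∀ k, ∀ v w : E4, deriv (fun s ↦ boostedKerrBilin (Λ s) (c s) M 0 (x k) v w) s₀ = 0) :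
    E4.spatial (D ((Λ s₀ : E4 ≃L[ℝ] E4) (E4.ofTimeSpace 1 0))) = 0 ∧
      E4.spatial ((((Λ s₀ : E4 ≃L[ℝ] E4).symm : E4 →L[ℝ] E4)) cdot) = 0 := by
  set L₀ : E4 →L[ℝ] E4 := ((Λ s₀ : E4 ≃L[ℝ] E4) : E4 →L[ℝ] E4) with hL₀
  set Li₀ : E4 →L[ℝ] E4 := (((Λ s₀ : E4 ≃L[ℝ] E4).symm : E4 →L[ℝ] E4)) with hLi₀
  set Ω : E4 →L[ℝ] E4 := D.comp L₀ with hΩ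
  set q : E4 := -(Li₀ cdot) with hq
  have hΩskew : ∀ A B, Minkowski.bilin (Ω A) B + Minkowski.bilin A (Ω B) = 0 := fun A B ↦
    minkowski_skew_of_hasDerivAt_lorentz_symm hΛ A B
  have hker := spatial_eq_zero_of_lieDeriv_skew_eq_zero_four_events hM hΩskew q
    (fun k ↦ poincareInv (Λ s₀) (c s₀) (x k)) hx hind (fun k A B ↦ ?_)
  · refine ⟨by simpa [hΩ, hL₀] using hker.1, ?_⟩
    have h2 := hker.2
    rwa [hq, map_neg, neg_eq_zero] at h2
  -- the hypothesis at event `k`, read through the path derivative with `v = Λ₀ A`, `w = Λ₀ B`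
  have hd := (hasDerivAt_boostedKerrBilin_zero_spin_motion (M := M) hΛ hc (hx k) (L₀ A) (L₀ B)).deriv
  rw [h k] at hd
  have hA : Li₀ (L₀ A) = A := by simp [hLi₀, hL₀]
  have hB : Li₀ (L₀ B) = B := by simp [hLi₀, hL₀]
  have hyk : D (x k - c s₀) = Ω (poincareInv (Λ s₀) (c s₀) (x k)) := by
    simp only [hΩ, hL₀, ContinuousLinearMap.coe_comp, Function.comp_apply, poincareInv,
      ContinuousLinearEquiv.coe_coe, ContinuousLinearEquiv.apply_symm_apply]
  rw [hA, hB, hyk] at hd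
  have hDA : D (L₀ A) = Ω A := by simp [hΩ, hL₀]
  have hDB : D (L₀ B) = Ω B := by simp [hΩ, hL₀]
  rw [hDA, hDB] at hd
  rw [hq, ← sub_eq_add_neg, hLi₀]
  exact hd.symm

end Path

/-- **Registered one-line carrier form** (`coer_motion_four_event_rigidity_s0`) of
`spatial_eq_zero_of_deriv_boostedKerrBilin_eq_zero_four_events`. [cite: KerrSchild1965, §2] -/
theorem coer_motion_four_event_rigidity_s0 : open Literature.Geometry.Lorentzian in ∀ {Λ : ℝ → lorentzGroup} {c : ℝ → E4} {M : ℝ} {s₀ : ℝ} {D : E4 →L[ℝ] E4} {cdot : E4}, M ≠ 0 → HasDerivAt (fun s ↦ (((Λ s : E4 ≃L[ℝ] E4).symm : E4 →L[ℝ] E4))) D s₀ → HasDerivAt c cdot s₀ → ∀ (x : Fin 4 → E4), (∀ k, E4.spatial (poincareInv (Λ s₀) (c s₀) (x k)) ≠ 0) → (∀ i j k : Fin 4, i ≠ j → j ≠ k → i ≠ k → LinearIndependent ℝ ![E4.spatial (poincareInv (Λ s₀) (c s₀) (x i)), E4.spatial (poincareInv (Λ s₀) (c s₀) (x j)), E4.spatial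 (poincareInv (Λ s₀) (c s₀) (x k))]) → (∀ k, ∀ v w : E4, deriv (fun s ↦ boostedKerrBilin (Λ s) (c s) M 0 (x k) v w) s₀ = 0) → E4.spatial (D ((Λ s₀ : E4 ≃L[ℝ] E4) (E4.ofTimeSpace 1 0))) = 0 ∧ E4.spatial ((((Λ s₀ : E4 ≃L[ℝ] E4).symm : E4 →L[ℝ] E4)) cdot) = 0 :=
  fun hM hΛ hc x hx hind h ↦ spatial_eq_zero_of_deriv_boostedKerrBilin_eq_zero_four_events hM hΛ hc x hx hind h

end Summit.FinalStateConjecture.FinalStateConjecture.Theorems.SublinearIsFree.Slaving
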